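import Literature.Analysis.ODE.DombSeries
import Mathlib.Analysis.Analytic.IsolatedZeros
import Mathlib.Analysis.Complex.CauchyIntegral
import HarnessLib

/-!
# The Domb series is the unique analytic solution of its Picard–Fuchs equation at `z = 0`

[BorweinEtAl2012, §4 Remark 6]: "`y₀` is the unique solution [of `B₄ y = 0`] which is analytic at
zero and takes the value `1` at zero". Here `B₄ = 64z²(θ+1)³ − 2z(2θ+1)(5θ²+5θ+2) + θ³`,
`θ = z d/dz`. We realise `θ` on functions `ℂ → ℂ` (`thetaOp f z = z f′(z)`), the operator in
expanded form (`dombOp`; the tree's `dombSeries_picardFuchs` says `dombOp dombSeries = 0` on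
`‖z‖ < 1/16`, `dombOp_dombSeries`), and prove (`dombOp_unique`):

  if `Y` is analytic at `0` and `dombOp Y = 0` on a punctured neighbourhood of `0`, then
  `Y = Y(0) · y₀` near `0`.

Proof (Frobenius, indicial polynomial `ρ³`): `W = Y − Y(0)y₀` is analytic with `W(0) = 0`; if
`W ≢ 0` then `W = zᵐ V`, `m ≥ 1`, `V(0) ≠ 0` (isolated zeros), and `θ(zᵐV) = zᵐ(θ+m)V` gives
`dombOp W = zᵐ · M` with `M(0) = m³ V(0) ≠ 0`, contradicting `M = 0` near `0`.

## References

* [BorweinEtAl2012] J. M. Borwein, A. Straub, J. Wan, W. Zudilin, *Densities of short uniform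
  random walks*, Canad. J. Math. 64 (2012), §4 Remark 6.
* E. L. Ince, *Ordinary Differential Equations*, §16.1 (regular singular points, Frobenius).
-/

noncomputable section

open Filter Topology Complex
open Literature.Combinatorics.Enumerative

namespace Literature.Analysis.ODE

/-! ### The Euler operator `θ = z d/dz` on functions -/

/-- `θf(z) = z f′(z)`. [folklore] -/
def thetaOp (f : ℂ → ℂ) : ℂ → ℂ := fun z => z * deriv f z

/-- `θ` at `0` vanishes. [folklore] -/
@[simp] theorem thetaOp_apply_zero (f : ℂ → ℂ) : thetaOp f 0 = 0 := by simp [thetaOp]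

/-- `θ` of an analytic function is analytic (on an open set of analyticity). [folklore] -/
theorem analyticOnNhd_thetaOp {f : ℂ → ℂ} {U : Set ℂ} (hf : AnalyticOnNhd ℂ f U) :
    AnalyticOnNhd ℂ (thetaOp f) U :=
  (analyticOnNhd_id).mul hf.deriv

/-- Iterates of `θ` of an analytic function are analytic. [folklore] -/
theorem analyticOnNhd_thetaOp_iterate {f : ℂ → ℂ} {U : Set ℂ} (hf : AnalyticOnNhd ℂ f U) (k : ℕ) :
    AnalyticOnNhd ℂ (thetaOp^[k] f) U := by
  induction k with
  | zero => exact hf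
  | succ k ih => rw [Function.iterate_succ_apply']; exact analyticOnNhd_thetaOp ih

/-- `θ` respects eventual equality at a point. [folklore] -/
theorem thetaOp_congr_of_eventuallyEq {f g : ℂ → ℂ} {z : ℂ} (h : f =ᶠ[𝓝 z] g) :
    thetaOp f z = thetaOp g z := by
  simp [thetaOp, h.deriv_eq]

/-- `θ` respects equality on an open set. [folklore] -/
theorem thetaOp_eqOn {f g : ℂ → ℂ} {U : Set ℂ} (hU : IsOpen U) (h : Set.EqOn f g U) :
    Set.EqOn (thetaOp f) (thetaOp g) U := fun _ hz =>
  thetaOp_congr_of_eventuallyEq (h.eventuallyEq_of_mem (hU.mem_nhds hz))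

/-- Iterated `θ` respects equality on an open set. [folklore] -/
theorem thetaOp_iterate_eqOn {f g : ℂ → ℂ} {U : Set ℂ} (hU : IsOpen U) (h : Set.EqOn f g U) (k : ℕ) :
    Set.EqOn (thetaOp^[k] f) (thetaOp^[k] g) U := by
  induction k with
  | zero => exact h
  | succ k ih => rw [Function.iterate_succ_apply', Function.iterate_succ_apply']; exact thetaOp_eqOn hU ih

/-- `θ` is linear on differentiable functions: `θ(f − c g) = θf − c θg`. [folklore] -/
theorem thetaOp_sub_const_mul {f g : ℂ → ℂ} {z : ℂ} (c : ℂ) (hf : DifferentiableAt ℂ f z)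
    (hg : DifferentiableAt ℂ g z) :
    thetaOp (fun w => f w - c * g w) z = thetaOp f z - c * thetaOp g z := by
  simp only [thetaOp]
  rw [deriv_fun_sub hf (hg.const_mul c), deriv_const_mul c hg]
  ring

/-- **`θ(zᵐ V) = zᵐ (θV + mV)`** for differentiable `V`. [folklore] -/
theorem thetaOp_pow_mul {V : ℂ → ℂ} {z : ℂ} (m : ℕ) (hV : DifferentiableAt ℂ V z) :
    thetaOp (fun w => w ^ m * V w) z = z ^ m * (thetaOp V z + m * V z) := by
  simp only [thetaOp]
  rw [deriv_fun_mul (differentiableAt_pow m) hV, deriv_pow_field]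
  rcases Nat.eq_zero_or_pos m with rfl | hm
  · simp
  · have : z * ((m : ℂ) * z ^ (m - 1)) = m * z ^ m := by
      rw [← mul_assoc, mul_comm z, mul_assoc, ← pow_succ', Nat.sub_add_cancel hm]
    linear_combination (V z) * this

/-! ### The Domb operator on functions -/

/-- `B₄` in expanded form on functions:
`64z²(θ³f + 3θ²f + 3θf + f) − 2z(10θ³f + 15θ²f + 9θf + 2f) + θ³f`. [cite: BorweinEtAl2012, §4 Remark 6] -/
def dombOp (f : ℂ → ℂ) (z : ℂ) : ℂ :=
  64 * z ^ 2 * ((thetaOp^[3] f) z + 3 * (thetaOp^[2] f) z + 3 * thetaOp f z + f z) -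
    2 * z * (10 * (thetaOp^[3] f) z + 15 * (thetaOp^[2] f) z + 9 * thetaOp f z + 2 * f z) +
      (thetaOp^[3] f) z

/-- `dombOp` respects equality on an open set. [folklore] -/
theorem dombOp_eqOn {f g : ℂ → ℂ} {U : Set ℂ} (hU : IsOpen U) (h : Set.EqOn f g U) :
    Set.EqOn (dombOp f) (dombOp g) U := fun z hz => by
  simp only [dombOp, h hz, thetaOp_eqOn hU h hz, thetaOp_iterate_eqOn hU h 2 hz,
    thetaOp_iterate_eqOn hU h 3 hz]

/-- The open disc `‖z‖ < 1/16`. [folklore] -/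
theorem isOpen_dombDisc : IsOpen {z : ℂ | ‖z‖ < 1 / 16} := isOpen_lt continuous_norm continuous_const

/-- On the disc, `θ^k y₀ = dombTheta k`. [folklore] -/
theorem thetaOp_iterate_dombSeries (k : ℕ) :
    Set.EqOn (thetaOp^[k] dombSeries) (dombTheta k) {z : ℂ | ‖z‖ < 1 / 16} := by
  induction k with
  | zero => intro z _; rfl
  | succ k ih =>
    intro z hz
    rw [Function.iterate_succ_apply']
    have h1 : thetaOp (thetaOp^[k] dombSeries) z = thetaOp (dombTheta k) z :=
      thetaOp_congr_of_eventuallyEq (ih.eventuallyEq_of_mem (isOpen_dombDisc.mem_nhds hz))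
    rw [h1, thetaOp, mul_deriv_dombTheta k hz]

/-- **`B₄ y₀ = 0` on `‖z‖ < 1/16`** (the tree's `dombSeries_picardFuchs`, operator form).
[cite: BorweinEtAl2012, §4 Remark 6] -/
theorem dombOp_dombSeries {z : ℂ} (hz : ‖z‖ < 1 / 16) : dombOp dombSeries z = 0 := by
  have h := dombSeries_picardFuchs hz
  simp only [dombOp, thetaOp_iterate_dombSeries 3 hz, thetaOp_iterate_dombSeries 2 hz,
    show thetaOp dombSeries z = dombTheta 1 z from thetaOp_iterate_dombSeries 1 hz]
  simpa [dombSeries] using h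

/-- `y₀` is analytic on the disc. [folklore] -/
theorem analyticOnNhd_dombSeries : AnalyticOnNhd ℂ dombSeries {z : ℂ | ‖z‖ < 1 / 16} :=
  (show DifferentiableOn ℂ dombSeries {z : ℂ | ‖z‖ < 1 / 16} from
    fun _ hz => (differentiableAt_dombTheta 0 hz).differentiableWithinAt).analyticOnNhd isOpen_dombDisc

/-- `y₀` is analytic at `0`. [folklore] -/
theorem analyticAt_dombSeries_zero : AnalyticAt ℂ dombSeries 0 :=
  analyticOnNhd_dombSeries 0 (by norm_num)

/-! ### Linearity of `dombOp` on analytic functions -/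

/-- `dombOp (f − c·g) = dombOp f − c·dombOp g` on an open set of analyticity. [folklore] -/
theorem dombOp_sub_const_mul {f g : ℂ → ℂ} {U : Set ℂ} (hU : IsOpen U) (hf : AnalyticOnNhd ℂ f U)
    (hg : AnalyticOnNhd ℂ g U) (c : ℂ) :
    Set.EqOn (dombOp (fun w => f w - c * g w)) (fun z => dombOp f z - c * dombOp g z) U := by
  -- iterated θ of the combination
  have key : ∀ k, Set.EqOn (thetaOp^[k] (fun w => f w - c * g w))
      (fun z => (thetaOp^[k] f) z - c * (thetaOp^[k] g) z) U := by
    intro k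
    induction k with
    | zero => intro z _; rfl
    | succ k ih =>
      intro z hz
      rw [Function.iterate_succ_apply', Function.iterate_succ_apply', Function.iterate_succ_apply']
      rw [thetaOp_eqOn hU ih hz]
      exact thetaOp_sub_const_mul c ((analyticOnNhd_thetaOp_iterate hf k z hz).differentiableAt)
        ((analyticOnNhd_thetaOp_iterate hg k z hz).differentiableAt)
  intro z hz
  simp only [dombOp, key 3 hz, key 2 hz, show thetaOp (fun w => f w - c * g w) z =
    thetaOp f z - c * thetaOp g z from key 1 hz]
  ring

/-! ### `dombOp (zᵐ V) = zᵐ · M` with `M(0) = m³ V(0)` -/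

/-- The shifted iterates `V_k = (θ + m)^k V`. [folklore] -/
def shiftTheta (m : ℕ) (V : ℂ → ℂ) : ℕ → ℂ → ℂ
  | 0 => V
  | k + 1 => fun z => thetaOp (shiftTheta m V k) z + m * shiftTheta m V k z

/-- The shifted iterates are analytic. [folklore] -/
theorem analyticOnNhd_shiftTheta {V : ℂ → ℂ} {U : Set ℂ} (hV : AnalyticOnNhd ℂ V U) (m k : ℕ) :
    AnalyticOnNhd ℂ (shiftTheta m V k) U := by
  induction k with
  | zero => exact hV
  | succ k ih => exact (analyticOnNhd_thetaOp ih).add (analyticOnNhd_const.mul ih)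

/-- Value at `0`: `V_k(0) = mᵏ V(0)`. [folklore] -/
theorem shiftTheta_apply_zero (m : ℕ) (V : ℂ → ℂ) (k : ℕ) : shiftTheta m V k 0 = (m : ℂ) ^ k * V 0 := by
  induction k with
  | zero => simp [shiftTheta]
  | succ k ih => simp [shiftTheta, ih, pow_succ]; ring

/-- **`θᵏ(zᵐ V) = zᵐ V_k`** on an open set of analyticity of `V`. [folklore] -/
theorem thetaOp_iterate_pow_mul {V : ℂ → ℂ} {U : Set ℂ} (hU : IsOpen U) (hV : AnalyticOnNhd ℂ V U)
    (m k : ℕ) : Set.EqOn (thetaOp^[k] (fun w => w ^ m * V w)) (fun z => z ^ m * shiftTheta m V k z) U := by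
  induction k with
  | zero => intro z _; rfl
  | succ k ih =>
    intro z hz
    rw [Function.iterate_succ_apply', thetaOp_eqOn hU ih hz]
    exact thetaOp_pow_mul m ((analyticOnNhd_shiftTheta hV m k z hz).differentiableAt)

/-- **`dombOp (zᵐ V) = zᵐ · M`** with
`M = 64z²(V₃+3V₂+3V₁+V) − 2z(10V₃+15V₂+9V₁+2V) + V₃`. [folklore] -/
theorem dombOp_pow_mul {V : ℂ → ℂ} {U : Set ℂ} (hU : IsOpen U) (hV : AnalyticOnNhd ℂ V U) (m : ℕ) :
    Set.EqOn (dombOp (fun w => w ^ m * V w))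
      (fun z => z ^ m * (64 * z ^ 2 * (shiftTheta m V 3 z + 3 * shiftTheta m V 2 z + 3 * shiftTheta m V 1 z + V z) -
        2 * z * (10 * shiftTheta m V 3 z + 15 * shiftTheta m V 2 z + 9 * shiftTheta m V 1 z + 2 * V z) +
          shiftTheta m V 3 z)) U := by
  intro z hz
  simp only [dombOp, thetaOp_iterate_pow_mul hU hV m 3 hz, thetaOp_iterate_pow_mul hU hV m 2 hz,
    show thetaOp (fun w => w ^ m * V w) z = z ^ m * shiftTheta m V 1 z from
      thetaOp_iterate_pow_mul hU hV m 1 hz]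
  ring

/-! ### Uniqueness of the analytic solution -/

/-- **The Domb series is the unique analytic solution at `0` up to scaling**: if `Y` is analytic
at `0` and `B₄Y = 0` on a punctured neighbourhood of `0`, then `Y = Y(0)·y₀` near `0`.
[cite: BorweinEtAl2012, §4 Remark 6] -/
theorem dombOp_unique {Y : ℂ → ℂ} (hY : AnalyticAt ℂ Y 0) (hL : ∀ᶠ z in 𝓝[≠] (0 : ℂ), dombOp Y z = 0) :
    ∀ᶠ z in 𝓝 (0 : ℂ), Y z = Y 0 * dombSeries z := by
  -- a common open ball of analyticity where the equation holds off `0`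
  obtain ⟨r₁, hr₁, hY₁⟩ : ∃ r > 0, AnalyticOnNhd ℂ Y (Metric.ball 0 r) := by
    obtain ⟨U, hUn, hUa⟩ := hY.exists_mem_nhds_analyticOnNhd
    obtain ⟨r, hr, hsub⟩ := Metric.mem_nhds_iff.mp hUn
    exact ⟨r, hr, hUa.mono hsub⟩
  rw [eventually_nhdsWithin_iff, Metric.eventually_nhds_iff] at hL
  obtain ⟨r₂, hr₂, hL₂⟩ := hL
  set r : ℝ := min (min r₁ r₂) (1 / 16) with hr_def
  have hr : 0 < r := lt_min (lt_min hr₁ hr₂) (by norm_num)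
  have hrr₁ : r ≤ r₁ := (min_le_left _ _).trans (min_le_left _ _)
  have hrr₂ : r ≤ r₂ := (min_le_left _ _).trans (min_le_right _ _)
  have hr16 : r ≤ 1 / 16 := min_le_right _ _
  set U : Set ℂ := Metric.ball 0 r with hU_def
  have hU : IsOpen U := Metric.isOpen_ball
  have h0U : (0 : ℂ) ∈ U := Metric.mem_ball_self hr
  have hYU : AnalyticOnNhd ℂ Y U := hY₁.mono (Metric.ball_subset_ball hrr₁)
  have hSU : AnalyticOnNhd ℂ dombSeries U := analyticOnNhd_dombSeries.mono fun z hz => by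
    have : dist z 0 < r := hz
    rw [dist_zero_right] at this
    exact lt_of_lt_of_le this hr16
  -- `W = Y − Y(0) y₀`
  set W : ℂ → ℂ := fun w => Y w - Y 0 * dombSeries w with hW_def
  have hWU : AnalyticOnNhd ℂ W U := hYU.sub (analyticOnNhd_const.mul hSU)
  have hW0 : W 0 = 0 := by simp [hW_def, dombSeries_zero]
  have hLW : ∀ z ∈ U, z ≠ 0 → dombOp W z = 0 := by
    intro z hz hz0
    have hzr : dist z 0 < r := hz
    have e := dombOp_sub_const_mul hU hYU hSU (Y 0) hz
    simp only at e
    rw [e, hL₂ (lt_of_lt_of_le hzr hrr₂) hz0,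
      dombOp_dombSeries (by rw [dist_zero_right] at hzr; exact lt_of_lt_of_le hzr hr16)]
    ring
  -- either `W ≡ 0` near `0` (done) or `W = zᵐ V`
  by_cases hW : ∀ᶠ z in 𝓝 (0 : ℂ), W z = 0
  · filter_upwards [hW] with z hz
    simp only [hW_def] at hz
    linear_combination hz
  · exfalso
    obtain ⟨m, V, hVa, hV0, hWV⟩ := (hWU 0 h0U).exists_eventuallyEq_pow_smul_nonzero_iff.mpr hW
    simp only [sub_zero, smul_eq_mul] at hWV
    -- `m ≥ 1`
    have hm : m ≠ 0 := by
      rintro rfl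
      have h := hWV.self_of_nhds
      rw [hW0, pow_zero, one_mul] at h
      exact hV0 h.symm
    -- a smaller ball where `V` is analytic and `W = zᵐ V`
    obtain ⟨U', hU'n, hVU'⟩ := hVa.exists_mem_nhds_analyticOnNhd
    obtain ⟨s, hs, hsub⟩ := Metric.mem_nhds_iff.mp (Filter.inter_mem (Filter.inter_mem hU'n hWV) (hU.mem_nhds h0U))
    set B : Set ℂ := Metric.ball 0 s with hB_def
    have hB : IsOpen B := Metric.isOpen_ball
    have hVB : AnalyticOnNhd ℂ V B := hVU'.mono fun z hz => (hsub hz).1.1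
    have hWB : Set.EqOn W (fun w => w ^ m * V w) B := fun z hz => (hsub hz).1.2
    have hBU : B ⊆ U := fun z hz => (hsub hz).2
    -- `dombOp W = zᵐ M` on `B`, hence `M = 0` on `B ∖ {0}`
    set M : ℂ → ℂ := fun z => 64 * z ^ 2 * (shiftTheta m V 3 z + 3 * shiftTheta m V 2 z +
        3 * shiftTheta m V 1 z + V z) - 2 * z * (10 * shiftTheta m V 3 z + 15 * shiftTheta m V 2 z +
        9 * shiftTheta m V 1 z + 2 * V z) + shiftTheta m V 3 z with hM_def
    have hM : ∀ z ∈ B, z ≠ 0 → M z = 0 := by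
      intro z hz hz0
      have h1 := dombOp_eqOn hB hWB hz
      rw [dombOp_pow_mul hB hVB m hz, hLW z (hBU hz) hz0] at h1
      exact (mul_eq_zero.mp h1.symm).resolve_left (pow_ne_zero m hz0)
    -- continuity of `M` at `0` forces `M 0 = 0`
    have hMc : ContinuousAt M 0 := by
      have hc : ∀ k, ContinuousAt (shiftTheta m V k) 0 := fun k =>
        (analyticOnNhd_shiftTheta hVB m k 0 (Metric.mem_ball_self hs)).continuousAt
      have hVc : ContinuousAt V 0 := (hVB 0 (Metric.mem_ball_self hs)).continuousAt
      simp only [hM_def]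
      fun_prop
    have hM0 : M 0 = 0 := by
      have h1 : Tendsto M (𝓝[≠] (0 : ℂ)) (𝓝 (M 0)) := hMc.tendsto.mono_left nhdsWithin_le_nhds
      have h2 : Tendsto M (𝓝[≠] (0 : ℂ)) (𝓝 0) := by
        refine (tendsto_const_nhds (x := (0 : ℂ))).congr' ?_
        have hBn : B ∈ 𝓝[≠] (0 : ℂ) := mem_nhdsWithin_of_mem_nhds (hB.mem_nhds (Metric.mem_ball_self hs))
        filter_upwards [hBn, self_mem_nhdsWithin] with z hz hz0
        exact (hM z hz hz0).symm
      exact tendsto_nhds_unique h1 h2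
    -- but `M 0 = m³ V 0 ≠ 0`
    have hM0' : M 0 = (m : ℂ) ^ 3 * V 0 := by
      simp only [hM_def, shiftTheta_apply_zero]
      ring
    rw [hM0'] at hM0
    exact hV0 ((mul_eq_zero.mp hM0).resolve_left (pow_ne_zero 3 (Nat.cast_ne_zero.mpr hm)))

end Literature.Analysis.ODE

end
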